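import Mathlib
import HarnessLib
import Summits.NavierStokesRegularity.NavierStokesRegularity.Theorems.PoloidalWindowDoorLrcModEntirePoleArgument

/-!
# Route `PoloidalWindowDoor`, item `LrcModEntire` (stmt-NavierStokesRegularity-20428), (Q4) column — B-POLE ALONG THE BRANCH (the assembler's interface)

Cell ns-regularity-ideate, LEAD-lineage seat ns-poloidal-K2-p3 g17 (`--supports stmt-NavierStokesRegularity-20428`).  Class-free.

`…PoleArgument.pole_argument` is stated for bare functions `ξ, υ, Z` of the curvature VALUE `κ ∈ K₀`.  The assembly has them as functions of the ARC LENGTH `s` on an interval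
`S₀` where `k′ ≠ 0` (`κ = k(s)`, `ξ = k″(s)`, `υ = k′(s)²`, `Z = Z(s)`), with the first integral (P) holding at `κ = k(s)`.  Here the transfer, with no inverse-function calculus:
★ `pole_argument_along` — `k` injective on an infinite set `S₀` (e.g. strictly monotone on an interval), (P) at `κ = k(s)` for all `s ∈ S₀`, `m ∈ W` (`W ∖ {0}` infinite, `c ≠ 0` on `W`),
Cramer determinant of three heights non-zero at one point ⊢ `k′(s) = 0` for some `s ∈ S₀`.  (Proof: `K₀ := k '' S₀`, sections by `Function.invFunOn`.)
So the assembler only has to produce an `s`-interval with `k′ ≠ 0` (then `k` is strictly monotone there, hence injective, and the conclusion contradicts `k′ ≠ 0`).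

WHAT THIS IS NOT: not a claim about Navier–Stokes regularity; class-free algebra for the research slots `stub_Q4curvedAperiodic` / `stub_Q4sonicLineNegIsolated` of registry twist_split v14.
-/

noncomputable section

set_option linter.dupNamespace false

namespace Summit.NavierStokesRegularity.NavierStokesRegularity.Theorems.PoloidalWindowDoorLrcModEntirePoleArgumentCurve

open Set Function
open Summit.NavierStokesRegularity.NavierStokesRegularity.Theorems.PoloidalWindowDoorLrcModEntirePoleArgument

/-- ★ **B-POLE along the branch.**  See the module docstring. -/
theorem pole_argument_along {S₀ W : Set ℝ} (hS₀ : S₀.Infinite) (hW : (W \ {0}).Infinite)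
    (k k₁ k₂ Zs c c' e₀ e₁ e₂ e₃ : ℝ → ℝ) (hinj : InjOn k S₀) (hc : ∀ m ∈ W, c m ≠ 0)
    (hP : ∀ s ∈ S₀, ∀ m ∈ W,
      k₂ s * (c' m * (1 - k s * m) ^ 2) + k₁ s ^ 2 * (3 * m * c' m * (1 - k s * m) + 4 * c m) - Zs s * (1 - k s * m) ^ 3
        + (1 - k s * m) ^ 3 * (e₀ m + e₁ m * k s + e₂ m * k s ^ 2 + e₃ m * k s ^ 3) = 0)
    {m₁ m₂ m₃ : ℝ} (hm₁ : m₁ ∈ W) (hm₂ : m₂ ∈ W) (hm₃ : m₃ ∈ W)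
    (hD : ∃ κ₀ : ℝ,
      (c' m₁ * (1 - κ₀ * m₁) ^ 2) * ((3 * m₂ * c' m₂ * (1 - κ₀ * m₂) + 4 * c m₂) * (-(1 - κ₀ * m₃) ^ 3)
          - (-(1 - κ₀ * m₂) ^ 3) * (3 * m₃ * c' m₃ * (1 - κ₀ * m₃) + 4 * c m₃))
        - (3 * m₁ * c' m₁ * (1 - κ₀ * m₁) + 4 * c m₁) * ((c' m₂ * (1 - κ₀ * m₂) ^ 2) * (-(1 - κ₀ * m₃) ^ 3)
          - (-(1 - κ₀ * m₂) ^ 3) * (c' m₃ * (1 - κ₀ * m₃) ^ 2))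
        + (-(1 - κ₀ * m₁) ^ 3) * ((c' m₂ * (1 - κ₀ * m₂) ^ 2) * (3 * m₃ * c' m₃ * (1 - κ₀ * m₃) + 4 * c m₃)
          - (3 * m₂ * c' m₂ * (1 - κ₀ * m₂) + 4 * c m₂) * (c' m₃ * (1 - κ₀ * m₃) ^ 2)) ≠ 0) :
    ∃ s ∈ S₀, k₁ s = 0 := by
  -- the curvature values and sections of `k` over them
  set K₀ : Set ℝ := k '' S₀ with hK₀_def
  have hK₀ : K₀.Infinite := hS₀.image hinj
  let σ : ℝ → ℝ := invFunOn k S₀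
  have hσ : ∀ κ ∈ K₀, σ κ ∈ S₀ ∧ k (σ κ) = κ := fun κ hκ => by
    obtain ⟨s, hs, rfl⟩ := hκ
    exact ⟨invFunOn_mem ⟨s, hs, rfl⟩, invFunOn_eq ⟨s, hs, rfl⟩⟩
  -- apply the pole argument to the sections
  obtain ⟨κ, hκ, hυ⟩ := pole_argument hK₀ hW (fun κ => k₂ (σ κ)) (fun κ => k₁ (σ κ) ^ 2) (fun κ => Zs (σ κ)) c c' e₀ e₁ e₂ e₃ hc
    (fun κ hκ m hm => by
      obtain ⟨hsS, hks⟩ := hσ κ hκ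
      have h := hP (σ κ) hsS m hm
      rw [hks] at h
      exact h)
    hm₁ hm₂ hm₃ hD
  obtain ⟨hsS, -⟩ := hσ κ hκ
  exact ⟨σ κ, hsS, pow_eq_zero_iff two_ne_zero |>.1 hυ⟩

end Summit.NavierStokesRegularity.NavierStokesRegularity.Theorems.PoloidalWindowDoorLrcModEntirePoleArgumentCurve

end
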